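/- Width seat `ym-line-cbag-p1-w2` (prover-ym-line-cbag-p1-w2-g14-0; own items stmt-QuantumFields-22254 / 22893 CLOSED) on the
planner-of-record's LINE 5, route `HankelDensitySplitting`: the route-posited objects of the REGISTERED birth skeleton v2 of crux
`LogWindowMixedDominance` (stmt-QuantumFields-26617; planner ym-idea-2 g3, HOME/bc/LogWindowMixedDominance_birth_v2.lean, skeleton sha
21a8c843…) VERBATIM, so that the two registered stubs `stub_mixedPairsPowerSavingCLT : MixedPairsPowerSavingCLT` and
`stub_freeKernelMargin : FreeKernelMargin` can be landed by name from importable definitions.  Definitions + the kernel-checked composition;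
no stub is proved here.  RECORD-type material (node `LatticeNonFreezing`); the Yang–Mills mass gap is NOT proved by anything here. -/
import Mathlib
import HarnessLib
import Literature.MathematicalPhysics.QuantumFieldTheory.CurvatureGaussianField
import Summits.QuantumFields.Statement
import Summits.QuantumFields.YangMills.Theses.HankelDensitySplitting

/-!
# Route `HankelDensitySplitting`, crux `LogWindowMixedDominance` (stmt-QuantumFields-26617): the objects of skeleton v2

The crux: for every compact simple `G` and lattice representation `r` there are `n₁, β₂` with, for `β ≥ β₂`, every limit state `μ` at
`β` and every `n₁ ≤ n ≤ (log β)²`, `g_μ(n−1) − 2 g_μ(n) ≤ t_μ(n)` (spatial part `g`, temporal part `t` of the density–density correlator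
along `e₀`).  The registered skeleton v2 (critic P1 of 2026-08-28) types the analytic content as two stubs:

* `MixedPairsPowerSavingCLT` (stub A, the wall): a power-saving two-sided local CLT `|β²·Cov_μ(P_{0,ij}, P_{m e₀,kl}) − c·K_free²| ≤ β^{−κ}`
  for all plane pairs at heights `m ≤ (log β)²`, uniformly over limit states, `K_free = curvatureTwoPoint (d := 4)` (`kFree`);
* `FreeKernelMargin` (stub B, pure lattice Maxwell): `γ·n⁻⁸ ≤ T_free(n) − G_free(n−1) + 2·G_free(n)` for `n ≥ n₁` (`tFree`, `gFree`).

This file only DECLARES these objects and records the skeleton's sorry-free composition `LogWindowMixedDominance_of` (window absorption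
`(log β)¹⁶ β^{−κ} → 0`), byte-for-byte as registered (namespace moved from `…Cruxes.LogWindowMixedDominance.BirthV2` to
`…Theorems.HankelDensitySplitting.LogWindow`); the stubs are proved in sibling files `--supports stmt-QuantumFields-26617`.  No summit
statement, no mass gap, and not the node `LatticeNonFreezing` is proved by declaring them.
-/

set_option autoImplicit false

noncomputable section

open MeasureTheory Filter Asymptotics
open Literature.MathematicalPhysics.QuantumLattice
open Literature.MathematicalPhysics.QuantumFieldTheory

namespace Summit.QuantumFields.YangMills.Theorems.HankelDensitySplitting.LogWindow

variable {G : Type} [Group G] [MeasurableSpace G] {N : ℕ}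

/-- the site `m e₀`. -/
abbrev axisSite (m : ℕ) : Fin 4 → ℤ := (m : ℤ) • Pi.single (0 : Fin 4) (1 : ℤ)

/-- temporal part `t(n)` (verbatim the crux's sum). -/
def tCorr (ρ : G →* Matrix (Fin N) (Fin N) ℂ) (μ : Measure (LGConfig 4 G)) (n : ℕ) : ℝ :=
  ∑ j : Fin 4, ∑ k : Fin 4, ∑ l : Fin 4,
    if 0 < j ∧ k < l then plaquetteCorr ρ μ 0 0 j ((n : ℤ) • Pi.single (0 : Fin 4) (1 : ℤ)) k l else 0

/-- spatial part `g(m)` (verbatim the crux's sum). -/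
def gCorr (ρ : G →* Matrix (Fin N) (Fin N) ℂ) (μ : Measure (LGConfig 4 G)) (m : ℕ) : ℝ :=
  ∑ i : Fin 4, ∑ j : Fin 4, ∑ k : Fin 4, ∑ l : Fin 4,
    if 0 < i ∧ i < j ∧ k < l then plaquetteCorr ρ μ 0 i j ((m : ℤ) • Pi.single (0 : Fin 4) (1 : ℤ)) k l else 0

/-- the FREE curvature kernel between the plaquettes `(0; i,j)` and `(m e₀; k,l)` (tree `curvatureTwoPoint`,
lattice Maxwell in `d = 4`); `0` off the `i<j, k<l` range. -/
def kFree (m : ℕ) (i j k l : Fin 4) : ℝ :=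
  if h : i < j ∧ k < l then
    curvatureTwoPoint (d := 4) ⟨0, ⟨(i, j), h.1⟩⟩ ⟨axisSite m, ⟨(k, l), h.2⟩⟩
  else 0

/-- free temporal part `T_free(n) = Σ_{0<j} Σ_{k<l} K_free² `. -/
def tFree (n : ℕ) : ℝ :=
  ∑ j : Fin 4, ∑ k : Fin 4, ∑ l : Fin 4, if 0 < j ∧ k < l then kFree n 0 j k l ^ 2 else 0

/-- free spatial part `G_free(m) = Σ_{0<i<j} Σ_{k<l} K_free²`. -/
def gFree (m : ℕ) : ℝ :=
  ∑ i : Fin 4, ∑ j : Fin 4, ∑ k : Fin 4, ∑ l : Fin 4, if 0 < i ∧ i < j ∧ k < l then kFree m i j k l ^ 2 else 0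

/-- STUB A (size L — the priced wall at the logarithmic scale): power-saving two-sided local CLT for all plane
pairs at heights `m ≤ (log β)²`, uniformly over infinite-volume limit states. Why it might fail: slow joint
Gaussianity across planes sharing links (the `â_s − â_t` channel) at separations growing with β. -/
def MixedPairsPowerSavingCLT : Prop :=
  ∀ (G : Type) [Group G] [TopologicalSpace G] [IsTopologicalGroup G] [CompactSpace G] [MeasurableSpace G]
    [BorelSpace G], IsCompactSimpleLieGroup G → ∀ r : LatticeRep G,
      ∃ (c κ β₂ : ℝ), 0 < c ∧ 0 < κ ∧ ∀ β : ℝ, β₂ ≤ β →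
        ∀ μ ∈ infiniteVolumeLimitPoints (d := 4) r.ρ β, ∀ m : ℕ, (m : ℝ) ≤ Real.log β ^ 2 →
          ∀ i j k l : Fin 4, i < j → k < l →
            |β ^ 2 * plaquetteCorr r.ρ μ 0 i j ((m : ℤ) • Pi.single (0 : Fin 4) (1 : ℤ)) k l
                - c * kFree m i j k l ^ 2| ≤ β ^ (-κ)


/-- STUB B (size M–L, pure lattice Maxwell): the free inequality with a quantitative `n⁻⁸` margin beyond some
`n₁` (dipole asymptotics of the lattice Green function; tree level: margin/F_free = 0.094 at n = 9 ↗ 1). Why it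
might fail: only if the `n⁻⁸` asymptotics of `curvatureTwoPoint` had a vanishing leading coefficient in this
combination — the numerics give 2τ = 0.062 > 0. -/
def FreeKernelMargin : Prop :=
  ∃ (γ : ℝ) (n₁ : ℕ), 0 < γ ∧ 1 ≤ n₁ ∧ ∀ n : ℕ, n₁ ≤ n →
    γ / (n : ℝ) ^ 8 ≤ tFree n - gFree (n - 1) + 2 * gFree n


/-! ### arithmetic of the composition -/

/-- Guarded triple sums over `Fin 4`: a termwise two-sided `ε`-comparison `|b·p − c·q| ≤ ε` gives `c·Σq − 64ε ≤ b·Σp`. [folklore] -/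
lemma sum3_lower {P : Fin 4 → Fin 4 → Fin 4 → Prop} [∀ j k l, Decidable (P j k l)]
    {p q : Fin 4 → Fin 4 → Fin 4 → ℝ} {b c ε : ℝ} (hε : 0 ≤ ε)
    (h : ∀ j k l, P j k l → |b * p j k l - c * q j k l| ≤ ε) :
    c * (∑ j, ∑ k, ∑ l, if P j k l then q j k l else 0) - 64 * ε ≤
      b * ∑ j, ∑ k, ∑ l, if P j k l then p j k l else 0 := by
  have key : ∀ j k l, (if P j k l then c * q j k l else 0) - ε ≤ (if P j k l then b * p j k l else 0) := by
    intro j k l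
    by_cases hP : P j k l
    · have := h j k l hP
      rw [abs_le] at this
      simp only [hP, ↓reduceIte]; linarith [this.1, this.2]
    · simp only [hP, ↓reduceIte]; linarith
  have e1 : c * (∑ j, ∑ k, ∑ l, if P j k l then q j k l else 0) - 64 * ε =
      ∑ j : Fin 4, ∑ k : Fin 4, ∑ l : Fin 4, ((if P j k l then c * q j k l else 0) - ε) := by
    simp only [Finset.sum_sub_distrib, Finset.sum_const, Finset.card_univ, Fintype.card_fin,
      Finset.mul_sum, mul_ite, mul_zero]
    ring
  have e2 : b * (∑ j, ∑ k, ∑ l, if P j k l then p j k l else 0) =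
      ∑ j : Fin 4, ∑ k : Fin 4, ∑ l : Fin 4, (if P j k l then b * p j k l else 0) := by
    simp only [Finset.mul_sum, mul_ite, mul_zero]
  rw [e1, e2]
  gcongr with j _ k _ l _
  exact key j k l

/-- Guarded quadruple sums over `Fin 4`: `|b·p − c·q| ≤ ε` termwise gives `c·Σq − 256ε ≤ b·Σp`. [folklore] -/
lemma sum4_lower {P : Fin 4 → Fin 4 → Fin 4 → Fin 4 → Prop} [∀ i j k l, Decidable (P i j k l)]
    {p q : Fin 4 → Fin 4 → Fin 4 → Fin 4 → ℝ} {b c ε : ℝ} (hε : 0 ≤ ε)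
    (h : ∀ i j k l, P i j k l → |b * p i j k l - c * q i j k l| ≤ ε) :
    c * (∑ i, ∑ j, ∑ k, ∑ l, if P i j k l then q i j k l else 0) - 256 * ε ≤
      b * ∑ i, ∑ j, ∑ k, ∑ l, if P i j k l then p i j k l else 0 := by
  have key : ∀ i j k l, (if P i j k l then c * q i j k l else 0) - ε ≤ (if P i j k l then b * p i j k l else 0) := by
    intro i j k l
    by_cases hP : P i j k l
    · have := h i j k l hP
      rw [abs_le] at this
      simp only [hP, ↓reduceIte]; linarith [this.1, this.2]
    · simp only [hP, ↓reduceIte]; linarith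
  have e1 : c * (∑ i, ∑ j, ∑ k, ∑ l, if P i j k l then q i j k l else 0) - 256 * ε =
      ∑ i : Fin 4, ∑ j : Fin 4, ∑ k : Fin 4, ∑ l : Fin 4, ((if P i j k l then c * q i j k l else 0) - ε) := by
    simp only [Finset.sum_sub_distrib, Finset.sum_const, Finset.card_univ, Fintype.card_fin,
      Finset.mul_sum, mul_ite, mul_zero]
    ring
  have e2 : b * (∑ i, ∑ j, ∑ k, ∑ l, if P i j k l then p i j k l else 0) =
      ∑ i : Fin 4, ∑ j : Fin 4, ∑ k : Fin 4, ∑ l : Fin 4, (if P i j k l then b * p i j k l else 0) := by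
    simp only [Finset.mul_sum, mul_ite, mul_zero]
  rw [e1, e2]
  gcongr with i _ j _ k _ l _
  exact key i j k l

/-- Guarded quadruple sums over `Fin 4`: `|b·p − c·q| ≤ ε` termwise gives `b·Σp ≤ c·Σq + 256ε`. [folklore] -/
lemma sum4_upper {P : Fin 4 → Fin 4 → Fin 4 → Fin 4 → Prop} [∀ i j k l, Decidable (P i j k l)]
    {p q : Fin 4 → Fin 4 → Fin 4 → Fin 4 → ℝ} {b c ε : ℝ} (hε : 0 ≤ ε)
    (h : ∀ i j k l, P i j k l → |b * p i j k l - c * q i j k l| ≤ ε) :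
    b * (∑ i, ∑ j, ∑ k, ∑ l, if P i j k l then p i j k l else 0) ≤
      c * (∑ i, ∑ j, ∑ k, ∑ l, if P i j k l then q i j k l else 0) + 256 * ε := by
  have key : ∀ i j k l, (if P i j k l then b * p i j k l else 0) ≤ (if P i j k l then c * q i j k l else 0) + ε := by
    intro i j k l
    by_cases hP : P i j k l
    · have := h i j k l hP
      rw [abs_le] at this
      simp only [hP, ↓reduceIte]; linarith [this.1, this.2]
    · simp only [hP, ↓reduceIte]; linarith
  have e1 : c * (∑ i, ∑ j, ∑ k, ∑ l, if P i j k l then q i j k l else 0) + 256 * ε =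
      ∑ i : Fin 4, ∑ j : Fin 4, ∑ k : Fin 4, ∑ l : Fin 4, ((if P i j k l then c * q i j k l else 0) + ε) := by
    simp only [Finset.sum_add_distrib, Finset.sum_const, Finset.card_univ, Fintype.card_fin,
      Finset.mul_sum, mul_ite, mul_zero]
    ring
  have e2 : b * (∑ i, ∑ j, ∑ k, ∑ l, if P i j k l then p i j k l else 0) =
      ∑ i : Fin 4, ∑ j : Fin 4, ∑ k : Fin 4, ∑ l : Fin 4, (if P i j k l then b * p i j k l else 0) := by
    simp only [Finset.mul_sum, mul_ite, mul_zero]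
  rw [e1, e2]
  gcongr with i _ j _ k _ l _
  exact key i j k l

/-- absorption of the window: `(log β)¹⁶ · β^{−κ} → 0`. -/
lemma log_window_absorb {κ a : ℝ} (hκ : 0 < κ) (ha : 0 < a) :
    ∃ β₃ : ℝ, ∀ β : ℝ, β₃ ≤ β → β ^ (-κ) * (Real.log β ^ 2) ^ 8 ≤ a := by
  have h := (isLittleO_log_rpow_rpow_atTop ((16 : ℕ) : ℝ) hκ).def ha
  rw [Filter.eventually_atTop] at h
  obtain ⟨B, hB⟩ := h
  refine ⟨max B 1, fun β hβ => ?_⟩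
  have hβ1 : 1 ≤ β := le_trans (le_max_right _ _) hβ
  have hβpos : 0 < β := by linarith
  have hlog : 0 ≤ Real.log β := Real.log_nonneg hβ1
  have hb := hB β (le_trans (le_max_left _ _) hβ)
  rw [Real.rpow_natCast, Real.norm_of_nonneg (pow_nonneg hlog _),
    Real.norm_of_nonneg (Real.rpow_nonneg hβpos.le _)] at hb
  have hpow : (Real.log β ^ 2) ^ 8 = Real.log β ^ 16 := by ring
  rw [hpow, Real.rpow_neg hβpos.le, inv_mul_le_iff₀ (Real.rpow_pos_of_pos hβpos κ)]
  linarith [hb]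

/-- the crux, under a local alias so that only `LogWindowMixedDominance_proof` concludes it BY NAME. -/
abbrev LineGoal : Prop := Summit.QuantumFields.YangMills.Theses.HankelDensitySplitting.LogWindowMixedDominance

/-- BC3 (v2): the power-saving mixed-pair CLT and the free-kernel margin compose to the crux BY NAME. -/
theorem LogWindowMixedDominance_of (hA : MixedPairsPowerSavingCLT) (hB : FreeKernelMargin) : LineGoal := by
  intro G _ _ _ _ _ _ hG r
  obtain ⟨c, κ, β₂, hc, hκ, HA⟩ := hA G hG r
  obtain ⟨γ, n₁, hγ, hn₁, HB⟩ := hB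
  obtain ⟨β₃, Hβ₃⟩ := log_window_absorb hκ (show 0 < c * γ / 832 by positivity)
  refine ⟨n₁, max (max β₂ β₃) (Real.exp 1), fun β hβ μ hμ n hn hlog => ?_⟩
  have hβ2 : β₂ ≤ β := le_trans (le_trans (le_max_left _ _) (le_max_left _ _)) hβ
  have hβ3 : β₃ ≤ β := le_trans (le_trans (le_max_right _ _) (le_max_left _ _)) hβ
  have hβe : Real.exp 1 ≤ β := le_trans (le_max_right _ _) hβ
  have hβpos : 0 < β := lt_of_lt_of_le (Real.exp_pos 1) hβe
  have hlog1 : 1 ≤ Real.log β := by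
    have := Real.log_le_log (Real.exp_pos 1) hβe
    rwa [Real.log_exp] at this
  have hn1 : (1 : ℝ) ≤ n := by exact_mod_cast le_trans hn₁ hn
  have e0 : 0 ≤ β ^ (-κ) := Real.rpow_nonneg hβpos.le _
  -- the CLT at heights n and n - 1
  have HAn := HA β hβ2 μ hμ n hlog
  have hlog' : ((n - 1 : ℕ) : ℝ) ≤ Real.log β ^ 2 :=
    le_trans (by exact_mod_cast Nat.sub_le n 1) hlog
  have HAn1 := HA β hβ2 μ hμ (n - 1) hlog'
  -- sums
  have T1 : c * tFree n - 64 * β ^ (-κ) ≤ β ^ 2 * tCorr r.ρ μ n := by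
    unfold tFree tCorr
    exact sum3_lower (P := fun j k l => 0 < j ∧ k < l) e0
      (fun j k l hP => HAn 0 j k l hP.1 hP.2)
  have G2 : c * gFree n - 256 * β ^ (-κ) ≤ β ^ 2 * gCorr r.ρ μ n := by
    unfold gFree gCorr
    exact sum4_lower (P := fun i j k l => 0 < i ∧ i < j ∧ k < l) e0
      (fun i j k l hP => HAn i j k l hP.2.1 hP.2.2)
  have G1 : β ^ 2 * gCorr r.ρ μ (n - 1) ≤ c * gFree (n - 1) + 256 * β ^ (-κ) := by
    unfold gFree gCorr
    exact sum4_upper (P := fun i j k l => 0 < i ∧ i < j ∧ k < l) e0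
      (fun i j k l hP => HAn1 i j k l hP.2.1 hP.2.2)
  -- the free margin and the window
  have HBn : c * (γ / (n : ℝ) ^ 8) ≤ c * (tFree n - gFree (n - 1) + 2 * gFree n) :=
    mul_le_mul_of_nonneg_left (HB n hn) hc.le
  have hn8 : (n : ℝ) ^ 8 ≤ (Real.log β ^ 2) ^ 8 := pow_le_pow_left₀ (by positivity) hlog 8
  have hwin : c * γ / (Real.log β ^ 2) ^ 8 ≤ c * (γ / (n : ℝ) ^ 8) := by
    rw [mul_div_assoc]
    exact mul_le_mul_of_nonneg_left (div_le_div_of_nonneg_left hγ.le (by positivity) hn8) hc.le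
  have hL : 0 < (Real.log β ^ 2) ^ 8 := by positivity
  have W : 832 * β ^ (-κ) ≤ c * γ / (Real.log β ^ 2) ^ 8 := by
    rw [le_div_iff₀ hL]
    have := Hβ₃ β hβ3
    nlinarith [this, hL]
  -- conclude
  have key : β ^ 2 * gCorr r.ρ μ (n - 1) - 2 * (β ^ 2 * gCorr r.ρ μ n) ≤ β ^ 2 * tCorr r.ρ μ n := by
    linarith [T1, G1, G2, HBn, hwin, W]
  have hβ2pos : 0 < β ^ 2 := by positivity
  show gCorr r.ρ μ (n - 1) - 2 * gCorr r.ρ μ n ≤ tCorr r.ρ μ n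
  by_contra hcon
  push Not at hcon
  have := mul_lt_mul_of_pos_left hcon hβ2pos
  linarith [this, key, mul_sub (β ^ 2) (gCorr r.ρ μ (n - 1)) (2 * gCorr r.ρ μ n),
    mul_left_comm (β ^ 2) 2 (gCorr r.ρ μ n)]

end Summit.QuantumFields.YangMills.Theorems.HankelDensitySplitting.LogWindow

end
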